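import Summits.CriticalPhenomena.Ising3D.IsingColumnFaceL11CensusWellPosed
import Summits.CriticalPhenomena.Ising3D.IsingColumnFaceL11CensusAlgRational

/-!
# The catalogue census of §7.3 as kernel facts, X (part 2): finiteness of the algebraic family `ALG` and its crowding
bound on the certified `Δε`-segment (cell `pub-ising3x`, seat recog-1; paper §1.6 / §7.3)

HONEST FRAMING: lottery ticket; floor = tightest certified 3D Ising CFT bounds; no exact-solution
claim without a proof. Island framing: certified exclusion region at stated derivative order and
assumptions; not a determination of the 3D Ising critical exponents beyond that.

`IsingColumnFaceL11CensusWellPosed.lean` turns the sharp covering radii of the two transcendental tables into crowding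
bounds (`≥ 783` / `≥ 295` / `≥ 1062` values in every closed `10⁻²` sub-interval of `[81/64, 2855/2048]`). The algebraic
family has a landed sharp covering radius too (`alg_meets_subinterval`: every closed sub-interval of length
`≥ 100734299·10⁻¹²` meets it, `IsingColumnFaceL11CensusGapsAlg.lean`, Appendix B.1.11), but the tree had no FINITENESS
statement for `algFamily d H`, without which a lower bound on `Set.ncard` says nothing. Here:
* **`algFamily_finite`** — `algFamily d H` (real roots of integer polynomials of degree exactly `d` and height `≤ H`) is
  a finite set: finitely many coefficient vectors (`Set.Finite.pi`), each a nonzero polynomial with finitely many real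
  roots (`Polynomial.rootSet_finite`, via the landed `polyOfFin` / `coeff_polyOfFin`); hence **`algTable_values_finite`**
  for the frozen table `algTable = [(1,1024), (2,64), (3,12), (4,6), (5,3), (6,2)]`;
* **`alg_centi_interval_ncard`** — every closed sub-interval of the segment of length `≥ 1/100` holds at least `99`
  distinct values of the algebraic table (`99·r < 10⁻² < 100·r`, `r = 100734299·10⁻¹²`; worst case, driven by the one wide
  hole below `4/3` — the census average is `≈ 4 600` per `10⁻²`), **`alg_milli_interval_ncard`** (`≥ 9` per `10⁻³`);
* **`realFamilies_centi_interval_ncard`** — the three real-valued families together, per closed `10⁻²` sub-interval: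
  `≥ 99` `ALG`, `≥ 783` `LIN`, `≥ 295` `TRG` values (no union count is claimed across `ALG` and the transcendental tables:
  whether an `ALG` value coincides with a `LIN`/`TRG` value is not decided in the tree).
Pure set theory over landed facts; no `decide` evaluation, no new enclosure, no relation-freeness assumed. A statement about
the frozen catalogue, NOT about `Δε`; nothing is recognised (§1.6).
lottery ticket; floor = tightest certified 3D Ising CFT bounds; no exact-solution claim without a proof.
-/

namespace Summit.CriticalPhenomena.Ising3D
namespace ColumnFaceL11
open Set Polynomial Literature.MathematicalPhysics.QuantumFieldTheory.ConformalBootstrap3D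

/-! ### Finiteness of the algebraic family -/

/-- A member of `algFamily d H` is a real root of the nonzero integer polynomial `polyOfFin c` of its coefficient
vector. [folklore] -/
theorem mem_rootSet_polyOfFin_of_coeffs {d : ℕ} {x : ℝ} {c : Fin (d + 1) → ℤ} (hlead : c (Fin.last d) ≠ 0)
    (hroot : ∑ i, (c i : ℝ) * x ^ (i : ℕ) = 0) : x ∈ (polyOfFin c).rootSet ℝ := by
  have hp0 : polyOfFin c ≠ 0 := by
    intro h0
    have := congrArg (fun q => q.coeff d) h0
    simp only [coeff_polyOfFin, coeff_zero, lt_add_iff_pos_right, zero_lt_one, dite_true] at this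
    exact hlead (by simpa [Fin.last] using this)
  refine (mem_rootSet_of_ne hp0).mpr ?_
  rw [polyOfFin, map_sum]
  simp only [aeval_monomial, algebraMap_int_eq, eq_intCast]
  exact hroot

/-- **`algFamily d H` is finite**: finitely many coefficient vectors of height `≤ H`, each giving a nonzero polynomial
with finitely many real roots. [folklore] -/
theorem algFamily_finite (d H : ℕ) : (algFamily d H).Finite := by
  have hC : (Set.pi Set.univ (fun _ : Fin (d + 1) => Set.Icc (-(H : ℤ)) H)).Finite :=
    Set.Finite.pi (fun _ => Set.finite_Icc _ _)
  have hsub : algFamily d H ⊆ ⋃ c ∈ Set.pi Set.univ (fun _ : Fin (d + 1) => Set.Icc (-(H : ℤ)) H),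
      (polyOfFin c).rootSet ℝ := by
    rintro x ⟨c, hlead, hH, hroot⟩
    exact Set.mem_biUnion (fun i _ => abs_le.mp (hH i)) (mem_rootSet_polyOfFin_of_coeffs hlead hroot)
  exact (hC.biUnion fun c _ => rootSet_finite (polyOfFin c) ℝ).subset hsub

/-- **The frozen algebraic table's value set is finite** (`algTable` = six `(degree, height)` rungs). [folklore] -/
theorem algTable_values_finite : {v : ℝ | ∃ dH ∈ algTable, v ∈ algFamily dH.1 dH.2}.Finite := by
  have h : {v : ℝ | ∃ dH ∈ algTable, v ∈ algFamily dH.1 dH.2} ⊆ ⋃ dH ∈ {dH : ℕ × ℕ | dH ∈ algTable},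
      algFamily dH.1 dH.2 := by
    rintro v ⟨dH, hdH, hv⟩; exact Set.mem_biUnion hdH hv
  exact ((algTable.finite_toSet).biUnion fun dH _ => algFamily_finite dH.1 dH.2).subset h

/-! ### Crowding of the algebraic table -/

/-- **`ALG` at `10⁻²`**: every closed sub-interval of the segment of length `≥ 1/100` holds at least `99` distinct values
of the algebraic table (`99·r < 1/100 < 100·r` for the sharp covering radius `r = 100734299·10⁻¹²` of
`alg_meets_subinterval`; worst case over the segment). [folklore] -/
theorem alg_centi_interval_ncard {a b : ℝ} (ha : (81 / 64 : ℝ) ≤ a) (hb : b ≤ 2855 / 2048)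
    (hab : (1 / 100 : ℝ) ≤ b - a) : 99 ≤ ({v : ℝ | ∃ dH ∈ algTable, v ∈ algFamily dH.1 dH.2} ∩ Set.Icc a b).ncard := by
  obtain ⟨f, hf, hmem⟩ := packing_of_meets (S := {v : ℝ | ∃ dH ∈ algTable, v ∈ algFamily dH.1 dH.2}) (by norm_num)
    (fun a b ha hb hab => alg_meets_subinterval a b ha hb hab) ha hb 99 (by norm_num at hab ⊢; linarith)
  exact le_ncard_of_injective (algTable_values_finite.subset Set.inter_subset_left) f hf
    (fun i => ⟨(hmem i).1, (hmem i).2.1, (hmem i).2.2⟩)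

/-- **`ALG` at `10⁻³`**: every closed sub-interval of the segment of length `≥ 1/1000` holds at least `9` distinct values
of the algebraic table. [folklore] -/
theorem alg_milli_interval_ncard {a b : ℝ} (ha : (81 / 64 : ℝ) ≤ a) (hb : b ≤ 2855 / 2048)
    (hab : (1 / 1000 : ℝ) ≤ b - a) : 9 ≤ ({v : ℝ | ∃ dH ∈ algTable, v ∈ algFamily dH.1 dH.2} ∩ Set.Icc a b).ncard := by
  obtain ⟨f, hf, hmem⟩ := packing_of_meets (S := {v : ℝ | ∃ dH ∈ algTable, v ∈ algFamily dH.1 dH.2}) (by norm_num)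
    (fun a b ha hb hab => alg_meets_subinterval a b ha hb hab) ha hb 9 (by norm_num at hab ⊢; linarith)
  exact le_ncard_of_injective (algTable_values_finite.subset Set.inter_subset_left) f hf
    (fun i => ⟨(hmem i).1, (hmem i).2.1, (hmem i).2.2⟩)

/-- **The three real-valued catalogue families crowd every certified-width interval**: every closed sub-interval of
`[81/64, 2855/2048]` of length `≥ 1/100` holds at least `99` values of the algebraic table, `783` of the linear-form
table and `295` of the trigonometric table (worst-case kernel lower bounds; no cross-family union is counted).
[folklore] -/
theorem realFamilies_centi_interval_ncard {a b : ℝ} (ha : (81 / 64 : ℝ) ≤ a) (hb : b ≤ 2855 / 2048)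
    (hab : (1 / 100 : ℝ) ≤ b - a) :
    99 ≤ ({v : ℝ | ∃ dH ∈ algTable, v ∈ algFamily dH.1 dH.2} ∩ Set.Icc a b).ncard ∧
      783 ≤ (linFamily 12 ∩ Set.Icc a b).ncard ∧ 295 ≤ (trgFullFamily 17 32 ∩ Set.Icc a b).ncard :=
  ⟨alg_centi_interval_ncard ha hb hab, lin_centi_interval_ncard ha hb hab, trg_centi_interval_ncard ha hb hab⟩

/-- The same at `10⁻³`: `≥ 9` / `≥ 78` / `≥ 29`. [folklore] -/
theorem realFamilies_milli_interval_ncard {a b : ℝ} (ha : (81 / 64 : ℝ) ≤ a) (hb : b ≤ 2855 / 2048)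
    (hab : (1 / 1000 : ℝ) ≤ b - a) :
    9 ≤ ({v : ℝ | ∃ dH ∈ algTable, v ∈ algFamily dH.1 dH.2} ∩ Set.Icc a b).ncard ∧
      78 ≤ (linFamily 12 ∩ Set.Icc a b).ncard ∧ 29 ≤ (trgFullFamily 17 32 ∩ Set.Icc a b).ncard :=
  ⟨alg_milli_interval_ncard ha hb hab, lin_milli_interval_ncard ha hb hab, trg_milli_interval_ncard ha hb hab⟩

end ColumnFaceL11
end Summit.CriticalPhenomena.Ising3D
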